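import Summits.BirchSwinnertonDyer.Rank1Residual.Supersingular.MazurTateLambdaReading
import Summits.BirchSwinnertonDyer.Rank1Residual.Supersingular.KobayashiSqueezeReal
import Summits.BirchSwinnertonDyer.Rank1Residual.Supersingular.SignedSqueeze
import HarnessLib

/-!
# The rank-one squeezes FED BY A MAZUR–TATE CERTIFICATE: `λ(θ_n) = deg ω_n^± + 1` on one level
# replaces the displayed `(μ, λ)(L^•) = (0, 1)` binders (classes X8 ♯/♭; X7 / X6 ±)
# (cell `b2b-bsdres`, supersingular family, prover B = unit `b2b-bsdres-additive-p3`, gen 4)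

HONEST FRAMING (run/shared/lean/b2b/bsd-rank1-residual/, verbatim in every file): the goal of the
cell is to DELETE the COMBINATION-SHAPED residual classes of the Birch–Swinnerton-Dyer formula for
ALL analytic-rank `≤ 1` elliptic curves over `ℚ` — "full BSD formula for every rank `≤ 1` curve in
class `C`" assembled STRICTLY from published theorems — so that the rank-`≤ 1` remainder becomes
exactly the CONSTRUCTION-SHAPED classes, which are TYPED (missing-input `Prop`s), NOT attempted.
This is not "finishing BSD". THEOREMS ONLY; X6 / X7 / X8 stay CONSTRUCTION-SHAPED; PER PAIR (one
certificate binder per pair); nothing about any curve is asserted; nothing booked.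

## What this file does

The rank-one squeezes of the cell — `X8.charIdealEq_of_lam_eq_one_of_analyticRank_eq_one`
(`SignedSqueeze.lean`, p208039: ♯/♭ at `a_3 = ±3`) and
`kobayashiMainConjecture_of_lam_eq_one_of_analyticRank_eq_one` (`KobayashiSqueezeReal.lean`, p213197:
Kobayashi ± at `a_p = 0`) — display the per-pair certificate as "`μ(L^•) = 0`, `λ(L^•) = 1`" on the
`p`-adic `L`-function. What the census seats' engines compute is `λ` of ONE Mazur–Tate element `θ_n`.
Gen 4 proved the bridge (`MazurTateReduction.lean` p214499, `MazurTateLambdaReading.lean`: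
`λ(θ_n) = deg ω_n^+ + λ(L♯)` for `n` odd, `= deg ω_n^- + λ(L♭)` for `n` even, when `μ(θ_n) = 0` and
`λ(θ_n) < pⁿ`). This file composes:

* `X8.span_eq_span_sharp_of_mazurTate_of_analyticRank_eq_one` /
  `X8.span_eq_span_flat_of_mazurTate_of_analyticRank_eq_one` — X8 ∧ `r_an = 1` ∧ surj(3): the ♯
  (resp. ♭) main conjecture AT THE PAIR, `(ξ) = (L♯_3(E))` (resp. `(L♭_3(E))`), for `f` the newform
  and ANY (= the unique) Sprung pair, from Wuthrich Lemma 20 + GZK + the displayed (C), (MC↑)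
  binders on `ξ` (as in p208039) and ONE MAZUR–TATE CERTIFICATE: an element `Θ ∈ Λ` with `ι Θ = θ_n`
  (`n` odd, resp. even), `Θ ≠ 0`, `μ(Θ) = 0`, `λ(Θ) = deg ω_n^± + 1 < pⁿ`;
* `kobayashiMainConjecture_of_mazurTate_of_analyticRank_eq_one` (+ `X7.`/`X6.` readings) — `a_p = 0`,
  `ρ̄_{E,p}` onto, `r_an = 1`: the cell's typed input `KobayashiMainConjecture W p ε` from A94/A98/
  period-unit facts/Lemma 20/GZK (by name, as in p213197) and ONE Mazur–Tate certificate at a level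
  `n` with `(−1)^n = ε` for the newform `f₀` of level `N_E` (the conjecture quantifies over newforms
  of that level only; `IsNewformOf.unique` transfers the certificate).

So per pair the ENTIRE analytic input of a rank-one squeeze is: one `p`-integral polynomial `θ_n` of
degree `< pⁿ` (two engines), its first unit coefficient at index `deg ω_n^± + 1 < pⁿ`. Census (gen 2,
iw-2 `ss_support_X678.tsv`, harvest-1 `x7r1_table.tsv`): 18 X8 and 31 X7 rank-one pairs `N < 2·10⁴`
with `min λ = 1` — the certificate shape above is what their two-engine rows must now exhibit.

References: [Pollack2003] Prop. 6.9–6.10; [Sprung2017] §3, Cor. 3.6, Thm. 1.12; [Sprung2012]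
Thm. 7.16, Main Conj. 7.21; [Kobayashi2003] Thm. 1.2, Thm. 4.1, Conjecture (p. 2); [Wuthrich2014]
Lemma 20; [GreenbergVatsal2000] p. 4. Memo: `HOME/b2b-bsdres-additive-p3/X8-ROUTE-B.md` §9 (gen 4).
-/

set_option autoImplicit false

noncomputable section

open scoped Classical MatrixGroups ModularForm

open CongruenceSubgroup WeierstrassCurve Literature.NumberTheory.EllipticCurves
  Literature.NumberTheory.EllipticCurves.ModularForms
  Literature.NumberTheory.EllipticCurves.Rank1Residual
  Literature.NumberTheory.EllipticCurves.Rank1Residual.Typed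
  Literature.NumberTheory.EllipticCurves.Sprung2017
  Literature.NumberTheory.EllipticCurves.Kobayashi2003 ZpExtension
  Summit.BirchSwinnertonDyer.Rank1Residual.X1.MuLambda

namespace Summit.BirchSwinnertonDyer.Rank1Residual.Supersingular

/-! ### X8 (♯/♭, `a_3 = ±3`): the main conjecture at a rank-one pair from a Mazur–Tate certificate -/

section X8

variable (W : WeierstrassCurve ℚ) [W.IsElliptic] [W.IsGloballyMinimal] (p : ℕ) [Fact p.Prime]

/-- **X8 ∧ `r_an = 1` ∧ surj(3), colour ♯: `(ξ) = (L♯_3(E))` at the pair from ONE odd-level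
Mazur–Tate certificate.** For `f` the newform of `E`, ANY Sprung pair `(L♯, L♭)` (the unique one),
`ξ ∈ Λ` with the displayed control `T^{rank E(ℚ)} ∣ ξ` ((C): Sprung 2024 Lemma 5.6) and integral Kato
divisibility under `3`-adic surjectivity ((MC↑): Sprung 2012 Thm. 7.16, `n = 0`; image by Wuthrich
Lemma 20, `hL20`), and a non-zero `Θ ∈ Λ` with `ι Θ = θ_n`, `n` odd, `μ(Θ) = 0`,
`λ(Θ) = deg ω_n^+ + 1 < 3ⁿ`: then `(ξ) = (L♯)` — Sprung's Main Conj. 7.21 for the datum `(ξ, L♯)`.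
PER PAIR; nothing asserted beyond the binders. [cite: Sprung2012, Thm. 7.16 and Main Conj. 7.21 (pp. 1504–1505)]
[cite: Pollack2003, Prop. 6.9 and Prop. 6.10] [cite: Sprung2017, §3, Cor. 3.6 and Thm. 1.12]
[cite: Wuthrich2014, Lemma 20 (p. 399)] [cite: GreenbergVatsal2000, p. 4] -/
theorem X8.span_eq_span_sharp_of_mazurTate_of_analyticRank_eq_one
    (hL20 : Wuthrich2014.lemma20_surjective_threeAdic_of_semistable)
    (hGZK : rank_eq_analyticRank_of_analyticRank_le_one)
    (hX : ClassX8 W p) (hs : Surj W p) (h1 : W.analyticRank = 1)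
    {N : ℕ} [NeZero N] {f : CuspForm (Gamma0 N) 2} (hf : IsNewformOf W f)
    {Lsharp Lflat : IwasawaAlgebra p} (hSP : IsSprungPair f p (W.frobeniusTrace p) Lsharp Lflat)
    (ξ : IwasawaAlgebra p) (hC : (PowerSeries.X : IwasawaAlgebra p) ^ W.mordellWeilRank ∣ ξ)
    (hKato : (∀ m : ℕ, W.HasSurjectiveModNGaloisRep (p ^ m : ℕ)) → ξ ∣ Lsharp)
    {n : ℕ} (hn : Odd n) {Θ : IwasawaAlgebra p}
    (hΘ : iwasawaToPowerSeries p Θ =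
      ((mazurTateElement f p n).map (algebraMap ℚ ℚ_[p]) : PowerSeries ℚ_[p]))
    (hΘ0 : Θ ≠ 0) (hμ : mu Θ = 0) (hlam : lam Θ = (cyclotomicOmegaPlus p n).natDegree + 1)
    (hlt : lam Θ < p ^ n) :
    Ideal.span ({ξ} : Set (IwasawaAlgebra p)) = Ideal.span {Lsharp} := by
  have hX' := hX
  obtain ⟨hp3, ⟨hgood, hap⟩, -⟩ := hX'
  subst hp3
  have hp2 : (3 : ℕ) ≠ 2 := by decide
  obtain ⟨hμL, hlamL⟩ := lam_sharp_eq_of_mazurTate hp2 hf hgood hap hSP hn hΘ hΘ0 hμ hlam hlt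
  exact X8.charIdealEq_of_lam_eq_one_of_analyticRank_eq_one W 3 hL20 hGZK hX hs h1 ⟨ξ, Lsharp, 0⟩ hC
    hKato hμL hlamL

/-- **X8 ∧ `r_an = 1` ∧ surj(3), colour ♭: `(ξ) = (L♭_3(E))` at the pair from ONE even-level
Mazur–Tate certificate** (`λ(Θ) = deg ω_n^- + 1 < 3ⁿ`, `n` even). PER PAIR.
[cite: Sprung2012, Thm. 7.16 and Main Conj. 7.21 (pp. 1504–1505)] [cite: Pollack2003, Prop. 6.9 and Prop. 6.10]
[cite: Sprung2017, §3, Cor. 3.6 and Thm. 1.12] [cite: Wuthrich2014, Lemma 20 (p. 399)] -/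
theorem X8.span_eq_span_flat_of_mazurTate_of_analyticRank_eq_one
    (hL20 : Wuthrich2014.lemma20_surjective_threeAdic_of_semistable)
    (hGZK : rank_eq_analyticRank_of_analyticRank_le_one)
    (hX : ClassX8 W p) (hs : Surj W p) (h1 : W.analyticRank = 1)
    {N : ℕ} [NeZero N] {f : CuspForm (Gamma0 N) 2} (hf : IsNewformOf W f)
    {Lsharp Lflat : IwasawaAlgebra p} (hSP : IsSprungPair f p (W.frobeniusTrace p) Lsharp Lflat)
    (ξ : IwasawaAlgebra p) (hC : (PowerSeries.X : IwasawaAlgebra p) ^ W.mordellWeilRank ∣ ξ)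
    (hKato : (∀ m : ℕ, W.HasSurjectiveModNGaloisRep (p ^ m : ℕ)) → ξ ∣ Lflat)
    {n : ℕ} (hn : Even n) {Θ : IwasawaAlgebra p}
    (hΘ : iwasawaToPowerSeries p Θ =
      ((mazurTateElement f p n).map (algebraMap ℚ ℚ_[p]) : PowerSeries ℚ_[p]))
    (hΘ0 : Θ ≠ 0) (hμ : mu Θ = 0) (hlam : lam Θ = (cyclotomicOmegaMinus p n).natDegree + 1)
    (hlt : lam Θ < p ^ n) :
    Ideal.span ({ξ} : Set (IwasawaAlgebra p)) = Ideal.span {Lflat} := by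
  have hX' := hX
  obtain ⟨hp3, ⟨hgood, hap⟩, -⟩ := hX'
  subst hp3
  have hp2 : (3 : ℕ) ≠ 2 := by decide
  obtain ⟨hμL, hlamL⟩ := lam_flat_eq_of_mazurTate hp2 hf hgood hap hSP hn hΘ hΘ0 hμ hlam hlt
  exact X8.charIdealEq_of_lam_eq_one_of_analyticRank_eq_one W 3 hL20 hGZK hX hs h1 ⟨ξ, Lflat, 0⟩ hC
    hKato hμL hlamL

end X8

/-! ### `a_p = 0` (X7 / X6, Kobayashi ±): the typed main conjecture from a Mazur–Tate certificate -/

section Signed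

variable (W : WeierstrassCurve ℚ) [W.IsElliptic] [W.IsGloballyMinimal] (p : ℕ) [Fact p.Prime]

/-- **Kobayashi's main conjecture for `(E, p, ε)` at a rank-one pair from a certificate AT THE
CONDUCTOR LEVEL.** As `kobayashiMainConjecture_of_lam_eq_one_of_analyticRank_eq_one` (p213197: A94,
A98, period-unit facts, Wuthrich Lemma 20, GZK by name; `p` odd good, `a_p = 0`, `ρ̄_{E,p}` onto,
`r_an = 1`), but with the certificate `hcert₀` stated for ONE newform `f₀` of level `N_E` only: the
conjecture quantifies over cusp forms of level `N_E` with `IsNewformOf W ·`, all equal to `f₀`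
(`IsNewformOf.unique`). [cite: Kobayashi2003, Thm. 1.2 (p. 2), Thm. 4.1 (p. 8) and Conjecture (p. 2)]
[cite: GreenbergVatsal2000, p. 4 and §3 Remark 3.4] [cite: Wuthrich2014, Lemma 20 (p. 399)] -/
theorem kobayashiMainConjecture_of_cert_at_conductor_of_analyticRank_eq_one
    (h12 : Kobayashi2003.thm12_signedSelmerDual_finite_torsion)
    (h41 : Kobayashi2003.thm41_signedCharIdeal_divisibility)
    (h5 : realPeriodRat_eq_unit_mul_plusPeriod) (h3 : realPeriodRat_eq_unit_mul_plusPeriod_three)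
    (hL20 : Wuthrich2014.lemma20_surjective_threeAdic_of_semistable)
    (hGZK : rank_eq_analyticRank_of_analyticRank_le_one)
    (hp : p ≠ 2) (hgood : W.HasGoodReductionAtPrime p) (hap : W.frobeniusTrace p = 0)
    (hs : Surj W p) (h1 : W.analyticRank = 1) (ε : ℤˣ)
    [NeZero (W.conductorNorm ℤ)] {f₀ : CuspForm (Gamma0 (W.conductorNorm ℤ)) 2} (hf₀ : IsNewformOf W f₀)
    (hcert₀ : ∀ L : IwasawaAlgebra p, IsSignedPAdicLFunction f₀ p ε L → mu L = 0 ∧ lam L = 1) :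
    KobayashiMainConjecture W p ε := by
  intro κ γ hκ hγ hγ' _ f hf ϖ hϖ Lplus Lminus hPP D
  -- the newform of the quantifier is `f₀`
  have hff : f = f₀ := hf.unique hf₀
  subst hff
  -- Thm. 1.2: `X^ε` finitely generated and torsion
  haveI : Module.Finite (IwasawaAlgebra p) D.X := h12.moduleFinite hp hgood hap hκ hγ D
  have hX : Module.IsTorsion (IwasawaAlgebra p) D.X := h12.isTorsion hp hgood hap hκ hγ D
  refine ⟨hX, ?_⟩
  obtain ⟨ξ, hξ⟩ := (charIdeal_isPrincipal_holds p D.X).principal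
  have hξ' : D.charIdeal = Ideal.span {ξ} := hξ
  set L := kobayashiL ε Lplus Lminus with hL_def
  have hL : IsSignedPAdicLFunction f p ε L := hPP.isSignedPAdicLFunction_kobayashiL ε
  have hsurj : ∀ m : ℕ, W.HasSurjectiveModNGaloisRep (p ^ m : ℕ) :=
    surjective_pow_of_surj_of_good W p hL20 hp hgood hs
  have hU : ξ ∣ L := h41.dvd_of_charIdeal_eq_span hp hgood hap hf hκ hγ hγ' hL D hX hsurj hξ'
  have hC := D.X_pow_mordellWeilRank_dvd_of_charIdeal_eq_span hγ hX hξ'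
  have hrank : W.mordellWeilRank = 1 := (hGZK W (by omega)).1.trans h1
  rw [hrank, pow_one] at hC
  obtain ⟨hμ, hlam⟩ := hcert₀ L hL
  have hspan : Ideal.span ({ξ} : Set (IwasawaAlgebra p)) = Ideal.span {L} :=
    span_eq_span_of_dvd_of_X_dvd_of_lam_eq_one hU hC hμ hlam
  have hirr : W.HasIrreducibleModPGaloisRep p :=
    hasIrreducibleModPGaloisRep_of_dvd_frobeniusTrace W p hp
      (W.not_dvd_minimalDiscriminantInt_of_hasGoodReductionAtPrime' p hgood) (by rw [hap]; exact dvd_zero _)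
  have hvϖ : padicValRat p ϖ = 0 := padicValRat_periodRatio_eq_zero h5 h3 W p hp hgood hirr f hf ϖ hϖ
  have hϖ0 : ϖ ≠ 0 := by
    intro h0
    rw [h0, Rat.cast_zero, zero_mul] at hϖ
    exact (IsNewform0.plusPeriod_pos_holds hf.1 hf.coeffField_eq_bot).ne' hϖ.symm
  obtain ⟨u, hu⟩ := exists_units_coe_eq_ratCast hϖ0 hvϖ
  obtain ⟨hspan', hι⟩ := span_C_units_mul_eq u L
  refine ⟨PowerSeries.C (u : ℤ_[p]) * L, ?_, ?_⟩
  · rw [hξ', hspan, hspan']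
  · rw [hι, hu]

/-- **Kobayashi's main conjecture for `(E, p, −1)` (the tree's `L⁺`, odd levels) at a rank-one pair
from ONE odd-level Mazur–Tate certificate**: `p` odd good, `a_p = 0`, `ρ̄_{E,p}` onto, `r_an = 1`,
the published facts by name, and for the newform `f₀` of level `N_E` a non-zero `Θ ∈ Λ` with
`ι Θ = θ_n`, `n` odd, `μ(Θ) = 0`, `λ(Θ) = deg ω_n^+ + 1 < pⁿ` ⇒ `KobayashiMainConjecture W p (-1)`.
PER PAIR. [cite: Kobayashi2003, Thm. 1.2, Thm. 4.1 and Conjecture (p. 2)] [cite: Pollack2003, Prop. 6.9, 6.10 and 6.18]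
[cite: GreenbergVatsal2000, p. 4 and §3 Remark 3.4] [cite: Wuthrich2014, Lemma 20 (p. 399)] -/
theorem kobayashiMainConjecture_neg_one_of_mazurTate_of_analyticRank_eq_one
    (h12 : Kobayashi2003.thm12_signedSelmerDual_finite_torsion)
    (h41 : Kobayashi2003.thm41_signedCharIdeal_divisibility)
    (h5 : realPeriodRat_eq_unit_mul_plusPeriod) (h3 : realPeriodRat_eq_unit_mul_plusPeriod_three)
    (hL20 : Wuthrich2014.lemma20_surjective_threeAdic_of_semistable)
    (hGZK : rank_eq_analyticRank_of_analyticRank_le_one)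
    (hp : p ≠ 2) (hgood : W.HasGoodReductionAtPrime p) (hap : W.frobeniusTrace p = 0)
    (hs : Surj W p) (h1 : W.analyticRank = 1)
    [NeZero (W.conductorNorm ℤ)] {f₀ : CuspForm (Gamma0 (W.conductorNorm ℤ)) 2} (hf₀ : IsNewformOf W f₀)
    {n : ℕ} (hn : Odd n) {Θ : IwasawaAlgebra p}
    (hΘ : iwasawaToPowerSeries p Θ =
      ((mazurTateElement f₀ p n).map (algebraMap ℚ ℚ_[p]) : PowerSeries ℚ_[p]))
    (hΘ0 : Θ ≠ 0) (hμ : mu Θ = 0) (hlam : lam Θ = (cyclotomicOmegaPlus p n).natDegree + 1)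
    (hlt : lam Θ < p ^ n) : KobayashiMainConjecture W p (-1) :=
  kobayashiMainConjecture_of_cert_at_conductor_of_analyticRank_eq_one W p h12 h41 h5 h3 hL20 hGZK hp
    hgood hap hs h1 (-1) hf₀ fun _ hL ↦
      lam_signed_neg_one_eq_of_mazurTate hp hf₀ hgood hap hL hn hΘ hΘ0 hμ hlam hlt

/-- **Kobayashi's main conjecture for `(E, p, 1)` (the tree's `L⁻`, even levels) at a rank-one pair
from ONE even-level Mazur–Tate certificate** (`λ(Θ) = deg ω_n^- + 1 < pⁿ`, `n` even). PER PAIR.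
[cite: Kobayashi2003, Thm. 1.2, Thm. 4.1 and Conjecture (p. 2)] [cite: Pollack2003, Prop. 6.9, 6.10 and 6.18]
[cite: GreenbergVatsal2000, p. 4 and §3 Remark 3.4] [cite: Wuthrich2014, Lemma 20 (p. 399)] -/
theorem kobayashiMainConjecture_one_of_mazurTate_of_analyticRank_eq_one
    (h12 : Kobayashi2003.thm12_signedSelmerDual_finite_torsion)
    (h41 : Kobayashi2003.thm41_signedCharIdeal_divisibility)
    (h5 : realPeriodRat_eq_unit_mul_plusPeriod) (h3 : realPeriodRat_eq_unit_mul_plusPeriod_three)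
    (hL20 : Wuthrich2014.lemma20_surjective_threeAdic_of_semistable)
    (hGZK : rank_eq_analyticRank_of_analyticRank_le_one)
    (hp : p ≠ 2) (hgood : W.HasGoodReductionAtPrime p) (hap : W.frobeniusTrace p = 0)
    (hs : Surj W p) (h1 : W.analyticRank = 1)
    [NeZero (W.conductorNorm ℤ)] {f₀ : CuspForm (Gamma0 (W.conductorNorm ℤ)) 2} (hf₀ : IsNewformOf W f₀)
    {n : ℕ} (hn : Even n) {Θ : IwasawaAlgebra p}
    (hΘ : iwasawaToPowerSeries p Θ =
      ((mazurTateElement f₀ p n).map (algebraMap ℚ ℚ_[p]) : PowerSeries ℚ_[p]))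
    (hΘ0 : Θ ≠ 0) (hμ : mu Θ = 0) (hlam : lam Θ = (cyclotomicOmegaMinus p n).natDegree + 1)
    (hlt : lam Θ < p ^ n) : KobayashiMainConjecture W p 1 :=
  kobayashiMainConjecture_of_cert_at_conductor_of_analyticRank_eq_one W p h12 h41 h5 h3 hL20 hGZK hp
    hgood hap hs h1 1 hf₀ fun _ hL ↦
      lam_signed_one_eq_of_mazurTate hp hf₀ hgood hap hL hn hΘ hΘ0 hμ hlam hlt

end Signed

end Summit.BirchSwinnertonDyer.Rank1Residual.Supersingular

end
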